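import Literature.NumberTheory.EllipticCurves.FormalGroupChartLimitLogEquivarianceProofs
import Literature.NumberTheory.EllipticCurves.LocalPointsIntegersSubgroup
import HarnessLib

/-!
# The limit logarithm, V: the completions `K_v` of a number field (instance of parts I–II)

`Proofs` file (theorems only, no definitions, no named facts) in topic
`NumberTheory/EllipticCurves`; continuation of `FormalGroupChartLimitLog{,Equivariance}Proofs`.
For a number field `K`, a finite place `v`, the completion `K_v = v.adicCompletion K` with its norm
valuation `‖·‖₊` (`NormedField.valuation`, the currency of `LocalPointsIntegersSubgroup`), a
Weierstrass equation `W₀` over `𝒪_v` and a natural number `p` with `p ∈ v` (so `0 < ‖p‖ < 1`):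

* `exists_limitLog_adicCompletion` — **a (SPEC)-logarithm exists on the level
  `E⁽ᵖ⁾(K_v) = {P ∈ E₁(K_v) : ‖z(P)‖ ≤ ‖p‖}`** of `W₀ ⊗ K_v` (completeness of `K_v` in the geometric
  form `LocalPoints.exists_limit_of_geometric` feeds the hypothesis `hcomplete` of part I's
  `exists_limitLog`); every theorem of parts I–IV (integrality `ℓ(E⁽ᵖ⁾) ⊆ p𝒪_v`, additivity, Galois
  equivariance, norm ↦ trace, base change, and — for unramified `v ∣ p`, where `E⁽ᵖ⁾ = E₁` by
  `level_val_natCast_eq_kernel` — the additive-reduction `E₀` statements of part III) applies to it.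

This is the instance the `bsd-addord` SAT₀ assembly uses for `K = ℚ(ζ_m)`, `v = w ∣ 3`: the
logarithm on `E₁(ℚ(ζ_m)_w)` in the same model of `K_w` as the semi-local isomorphism
`ℚ_[3] ⊗ ℚ(ζ_m) ≅ ∏_w ℚ(ζ_m)_w` of `AdelicBaseChange/PadicTensorCompletionProofs`.

## References

* [SilvermanAEC2009] J. H. Silverman, *The Arithmetic of Elliptic Curves*, 2nd ed. (2009), Thm. IV.6.4,
  Prop. VII.2.2.

## Design

No definitions; the `w`-integrality of `W₀ ⊗ K_v` is the instance argument `hV`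
(`LocalPoints.isIntegral_baseChange v W₀`).  `noncomputable section`; axioms standard.
-/

noncomputable section

open scoped Classical NNReal NumberField
open IsDedekindDomain NumberField

namespace Literature.NumberTheory.EllipticCurves.FormalGroupChart

universe u

variable {K : Type u} [Field K] [NumberField K] (v : HeightOneSpectrum (𝓞 K))
  (W₀ : WeierstrassCurve (v.adicCompletionIntegers K))
  [hV : (W₀.baseChange (v.adicCompletion K)).IsIntegral
    (NormedField.valuation (K := v.adicCompletion K)).integer]

/-- **A (SPEC)-logarithm on `E⁽ᵖ⁾(K_v)`** for the completion `K_v` of a number field at a finite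
place `v ∋ p`: there is `ℓ : E(K_v) → K_v` with `‖ℓ(Q) − z(pʳ·Q)/pʳ‖ ≤ ‖p‖^{r+1}` for every
`Q ∈ E⁽ᵖ⁾(K_v)` (`‖z(Q)‖ ≤ ‖p‖`) and every `r` — the hypothesis `hcomplete` of part I's
`exists_limitLog` being the completeness of `K_v` (`LocalPoints.exists_limit_of_geometric`).
[cite: SilvermanAEC2009, Thm. IV.6.4 with Prop. VII.2.2] -/
theorem exists_limitLog_adicCompletion {p : ℕ} (hprime : p.Prime) (hp : (p : 𝓞 K) ∈ v.asIdeal) :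
    ∃ ℓ : (W₀.baseChange (v.adicCompletion K)).toAffine.Point → v.adicCompletion K,
      ∀ Q ∈ level (NormedField.valuation (K := v.adicCompletion K))
          (W₀.baseChange (v.adicCompletion K))
          (NormedField.valuation (K := v.adicCompletion K) (p : v.adicCompletion K)), ∀ r : ℕ,
        NormedField.valuation (K := v.adicCompletion K)
            (ℓ Q - ((p ^ r) • Q).zCoord / (p : v.adicCompletion K) ^ r) ≤
          NormedField.valuation (K := v.adicCompletion K) (p : v.adicCompletion K) ^ (r + 1) := by
  have hp1 : NormedField.valuation (K := v.adicCompletion K) (p : v.adicCompletion K) < 1 :=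
    LocalPoints.valuation_natCast_lt_one v hp
  have hp0 : (p : v.adicCompletion K) ≠ 0 := by
    rw [← map_natCast (algebraMap K (v.adicCompletion K)) p]
    exact (map_ne_zero _).mpr (Nat.cast_ne_zero.mpr hprime.ne_zero)
  refine exists_limitLog hp0 fun x hx ↦ ?_
  obtain ⟨y, hy⟩ := LocalPoints.exists_limit_of_geometric v x
    (NormedField.valuation (K := v.adicCompletion K) (p : v.adicCompletion K))
    (NormedField.valuation (K := v.adicCompletion K) (p : v.adicCompletion K)) hp1
    (fun k ↦ by rw [← pow_succ']; exact hx k)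
  exact ⟨y, fun r ↦ by rw [pow_succ']; exact hy r⟩

/-- The same packaged with the `𝒪_v`-integrality instance discharged by
`LocalPoints.isIntegral_baseChange` (so that consumers need no `haveI`): a (SPEC)-logarithm on
`E⁽ᵖ⁾(K_v)` exists for every Weierstrass equation over `𝒪_v`.
[cite: SilvermanAEC2009, Thm. IV.6.4 with Prop. VII.2.2] -/
theorem exists_limitLog_adicCompletion' {p : ℕ} (hprime : p.Prime) (hp : (p : 𝓞 K) ∈ v.asIdeal)
    (X₀ : WeierstrassCurve (v.adicCompletionIntegers K)) :
    haveI := LocalPoints.isIntegral_baseChange v X₀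
    ∃ ℓ : (X₀.baseChange (v.adicCompletion K)).toAffine.Point → v.adicCompletion K,
      ∀ Q ∈ level (NormedField.valuation (K := v.adicCompletion K))
          (X₀.baseChange (v.adicCompletion K))
          (NormedField.valuation (K := v.adicCompletion K) (p : v.adicCompletion K)), ∀ r : ℕ,
        NormedField.valuation (K := v.adicCompletion K)
            (ℓ Q - ((p ^ r) • Q).zCoord / (p : v.adicCompletion K) ^ r) ≤
          NormedField.valuation (K := v.adicCompletion K) (p : v.adicCompletion K) ^ (r + 1) :=
  haveI := LocalPoints.isIntegral_baseChange v X₀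
  exists_limitLog_adicCompletion v X₀ hprime hp

end Literature.NumberTheory.EllipticCurves.FormalGroupChart

end
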